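import Summits.HodgeConjecture.CorCM.Census.QuarticTwistSquares

/-!
# The octic twist `(ℤ/8 × B, (4,0))`, I: THE PAIR MODEL — types `Ty B × Ty B`, marginals, the Hodge lattice, pairs, motions, blocks

COR-CM (cell `pub-hodgecm2`), count-neutral kernel combinatorics by the binder seat b09 (gen 33; lane COINVARIANT-TWIST / OCTIC RECON, the
model file of the octic road map `HOME/pub-hodgecm2-b09/lean-g32/QUARTIC-TWIST.md` PART VI and `…/lean-g33/COINVARIANT-TWIST.md` PART B–C),
on top of this seatʼs clock model of the quartic twist (`Census/QuarticTwistModel.lean`: `Ty B = B → ZMod 4`, `coef`, `tw`, `transl`, `hodge`,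
`pairVec`; `Census/QuarticTwistSquares.lean`: `flip`, `plc`, `faceVec`, `transl_faceVec`) used BY NAME.  Bookkeeping definitions with bodies
(`tens`, `marg₀`, `marg₁`, `hodge₂`, `pairVec₂`, `pairs₂`, `tw₂`, `sig`, `act`, `actInv`, `actEquiv`, `orbitRel₂`, `Orb₂`) + theorems; part II
(`Census/OcticTwistMotion.lean`) adds the translation of exponent vectors and the faces;
no `Prop`-valued definition, no `decide`, no certificate, no named fact, no `sorry`.
HONEST FRAMING: `HC_CM` is NOT proved, here or anywhere in the tree; nothing here is a period or a headline.

THE MODEL (seat b23ʼs index-two descent `Census/IndexTwoDescent{Dictionary,Hodge,Blocks}.lean` read in clock labels).  For `G = ℤ/8 × B`,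
`c = (4,0)`, the index-two subgroup `H = 2ℤ/8 × B ≅ ℤ/4 × B ∋ c` is the QUARTIC twist and `x = (1,0) ∉ H`, `x² = (1,0)_H`.  A CM type of
`(G,c)` is a PAIR `T = (s₀, s₁)` of clock types `B → ℤ/4` (`typePairEquiv`; column `b` of the type is `{2s₀b, 2s₀b+2} ∪ {2s₁b+1, 2s₁b+3} ⊂ ℤ/8`):
* **`Ty₂ B = Ty B × Ty B`**, exponent vectors `Ty₂ B → ℤ`, outer products `tens v w (s,t) = v s · w t` (§1);
* the two **marginals** `marg₀ m s = Σ_t m (s,t)`, `marg₁ m t = Σ_s m (s,t)` (linear; `marg₀ (tens v w) = (Σ w)•v`, `marg₁ (tens v w) = (Σ v)•w`);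
* **the octic Hodge lattice `hodge₂ = {m | marg₀ m ∈ hodge B ∧ marg₁ m ∈ hodge B}`** (§2; b23ʼs `mem_hodgeSpan_iff_marg`: the Pohlmann form of
  `xᵉ h` on a pair type is the quartic form of `h` on its `e`-th coordinate), the octic PAIRS `pairVec₂ (s,t) = e_{(s,t)} + e_{(s+2,t+2)}`
  (`c = x⁴` shifts BOTH coordinates by `2`; NOTE `(e_s + e_{s+2}) ⊗ e_t` is NOT an octic pair), `pairs₂ ≤ hodge₂`;
* **motions** (§3): `H` acts diagonally, `tw₂ h (s,t) = (tw h s, tw h t)`, and `x` by the SWAP-TWIST `sig (s,t) = (tw (1,0) t, s)` (`sig ∘ sig = tw₂ (1,0)`,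
  `sig ∘ tw₂ h = tw₂ h ∘ sig`; b23ʼs `res₀_rt_x`/`res₁_rt_x` is `sig⁻¹`); every element of `G = H ⊔ xH` is a motion `act e h = tw₂ h ∘ sigᵉ`
  (`e : Bool`) with the composition laws `act_false_false` … `act_true_true` and explicit inverses (`actInv`, `actEquiv`) — no `ℤ/8` arithmetic is needed; the BLOCKS
  `Orb₂ B` are the classes of `orbitRel₂` (`∃ e h, act e h T = T'`), a finite type;
* part II (`Census/OcticTwistMotion.lean`): translation of exponent vectors by motions, stability of `hodge₂` / `pairs₂`, and the COSET and
  MIXED faces as octic Hodge vectors; here already: outer products with a Hodge factor of mass zero, or with two factors of mass zero, are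
  octic Hodge vectors (`tens_mem_hodge₂_left/right`, `tens_mem_hodge₂_of_sum_eq_zero`).
Numerically (lane note PART B): with one potential-reducing face per block off ten residual blocks and nine closing faces, `β − 1` such faces
generate `hodge₂` modulo `pairs₂` for `B = ℤ/2, ℤ/3` (`μ = 17, 171`); the generation theorem is the successor filesʼ business.

## References
* [Pohlmann1968] H. Pohlmann, Algebraic cycles on abelian varieties of complex multiplication type, Ann. of Math. 88 (1968), Thm 1.
* [Milne1999] J. S. Milne, Lefschetz motives and the Tate conjecture, Compositio Math. 117 (1999), Prop. 2.1, p. 54.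
-/

namespace Summit.HodgeConjecture.CorCM.Census.OcticTwist

open Finset
open Summit.HodgeConjecture.CorCM.Census.QuarticTwist

variable (B : Type) [AddGroup B] [Fintype B] [DecidableEq B]

/-! ## §1 Pair types, outer products, marginals -/

/-- **Octic types**: pairs of clock types (the two restrictions of a CM type of `(ℤ/8 × B, (4,0))` to the cosets of `2ℤ/8 × B`). [folklore] -/
abbrev Ty₂ : Type := Ty B × Ty B

/-- The outer product of two quartic exponent vectors: `tens v w (s,t) = v s · w t`. [folklore] -/
def tens (v w : Ty B → ℤ) : Ty₂ B → ℤ := fun T => v T.1 * w T.2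

/-- **The first marginal** `marg₀ m s = Σ_t m (s,t)`. [folklore] -/
def marg₀ : (Ty₂ B → ℤ) →ₗ[ℤ] (Ty B → ℤ) where
  toFun m := fun s => ∑ t, m (s, t)
  map_add' m m' := by
    funext s
    simp only [Pi.add_apply, sum_add_distrib]
  map_smul' c m := by
    funext s
    simp only [Pi.smul_apply, smul_eq_mul, RingHom.id_apply, mul_sum]

/-- **The second marginal** `marg₁ m t = Σ_s m (s,t)`. [folklore] -/
def marg₁ : (Ty₂ B → ℤ) →ₗ[ℤ] (Ty B → ℤ) where
  toFun m := fun t => ∑ s, m (s, t)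
  map_add' m m' := by
    funext t
    simp only [Pi.add_apply, sum_add_distrib]
  map_smul' c m := by
    funext t
    simp only [Pi.smul_apply, smul_eq_mul, RingHom.id_apply, mul_sum]

omit [AddGroup B] in
/-- `marg₀ m s = Σ_t m (s,t)`. [folklore] -/
theorem marg₀_apply (m : Ty₂ B → ℤ) (s : Ty B) : marg₀ B m s = ∑ t, m (s, t) := rfl

omit [AddGroup B] in
/-- `marg₁ m t = Σ_s m (s,t)`. [folklore] -/
theorem marg₁_apply (m : Ty₂ B → ℤ) (t : Ty B) : marg₁ B m t = ∑ s, m (s, t) := rfl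

omit [AddGroup B] in
/-- **`marg₀ (v ⊗ w) = (Σ w) • v`.** [folklore] -/
theorem marg₀_tens (v w : Ty B → ℤ) : marg₀ B (tens B v w) = (∑ t, w t) • v := by
  funext s
  rw [marg₀_apply, Pi.smul_apply, smul_eq_mul, mul_comm, mul_sum]
  rfl

omit [AddGroup B] in
/-- **`marg₁ (v ⊗ w) = (Σ v) • w`.** [folklore] -/
theorem marg₁_tens (v w : Ty B → ℤ) : marg₁ B (tens B v w) = (∑ s, v s) • w := by
  funext t
  rw [marg₁_apply, Pi.smul_apply, smul_eq_mul, sum_mul]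
  rfl

omit [AddGroup B] [DecidableEq B] in
/-- A unit vector at a pair type is an outer product of unit vectors. [folklore] -/
theorem single_eq_tens (s t : Ty B) (c : ℤ) : (Pi.single (s, t) c : Ty₂ B → ℤ) = tens B (Pi.single s c) (Pi.single t 1) := by
  funext T
  obtain ⟨s', t'⟩ := T
  show (Pi.single (s, t) c : Ty₂ B → ℤ) (s', t') = (Pi.single s c : Ty B → ℤ) s' * (Pi.single t (1 : ℤ) : Ty B → ℤ) t'
  by_cases hs : s' = s
  · by_cases ht : t' = t
    · rw [hs, ht, Pi.single_eq_same, Pi.single_eq_same, Pi.single_eq_same, mul_one]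
    · rw [Pi.single_eq_of_ne (show (s', t') ≠ (s, t) from fun h => ht (Prod.ext_iff.mp h).2), Pi.single_eq_of_ne ht, mul_zero]
  · rw [Pi.single_eq_of_ne (show (s', t') ≠ (s, t) from fun h => hs (Prod.ext_iff.mp h).1), Pi.single_eq_of_ne hs, zero_mul]

omit [AddGroup B] in
/-- `marg₀ e_{(s,t)} = e_s`. [folklore] -/
theorem marg₀_single (s t : Ty B) (c : ℤ) : marg₀ B (Pi.single (s, t) c) = Pi.single s c := by
  rw [single_eq_tens, marg₀_tens, Finset.sum_pi_single', if_pos (mem_univ t), one_smul]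

omit [AddGroup B] in
/-- `marg₁ e_{(s,t)} = e_t` (for `c = 1`; in general `c • e_t`). [folklore] -/
theorem marg₁_single (s t : Ty B) (c : ℤ) : marg₁ B (Pi.single (s, t) c) = c • Pi.single t 1 := by
  rw [single_eq_tens, marg₁_tens, Finset.sum_pi_single', if_pos (mem_univ s)]

/-! ## §2 The octic Hodge lattice and the octic pairs -/

/-- **The octic Hodge lattice**: exponent vectors on pair types both of whose marginals are quartic Hodge vectors (the Pohlmann form of
`xᵉ h` on a pair type is the quartic form of `h` on the `e`-th coordinate). [cite: Pohlmann1968, Thm 1] -/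
def hodge₂ : Submodule ℤ (Ty₂ B → ℤ) := (hodge B).comap (marg₀ B) ⊓ (hodge B).comap (marg₁ B)

omit [AddGroup B] in
/-- Membership in `hodge₂`. [folklore] -/
theorem mem_hodge₂_iff (m : Ty₂ B → ℤ) : m ∈ hodge₂ B ↔ marg₀ B m ∈ hodge B ∧ marg₁ B m ∈ hodge B := Iff.rfl

/-- **The octic pair** through `(s,t)`: `e_{(s,t)} + e_{(s+2,t+2)}` (`c = x⁴` shifts both coordinates by two). [folklore] -/
def pairVec₂ (T : Ty₂ B) : Ty₂ B → ℤ := Pi.single T 1 + Pi.single (T.1 + 2, T.2 + 2) 1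

/-- The sublattice of octic pairs. [folklore] -/
def pairs₂ : Submodule ℤ (Ty₂ B → ℤ) := Submodule.span ℤ (Set.range (pairVec₂ B))

omit [AddGroup B] in
/-- The marginals of an octic pair are quartic pairs. [folklore] -/
theorem marg₀_pairVec₂ (T : Ty₂ B) : marg₀ B (pairVec₂ B T) = pairVec B T.1 := by
  obtain ⟨s, t⟩ := T
  unfold pairVec₂ pairVec
  rw [map_add, marg₀_single, marg₀_single]

omit [AddGroup B] in
/-- The marginals of an octic pair are quartic pairs. [folklore] -/
theorem marg₁_pairVec₂ (T : Ty₂ B) : marg₁ B (pairVec₂ B T) = pairVec B T.2 := by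
  obtain ⟨s, t⟩ := T
  unfold pairVec₂ pairVec
  rw [map_add, marg₁_single, marg₁_single, one_smul, one_smul]

omit [AddGroup B] in
/-- **Octic pairs are octic Hodge vectors.** [folklore] -/
theorem pairVec₂_mem (T : Ty₂ B) : pairVec₂ B T ∈ hodge₂ B := by
  rw [mem_hodge₂_iff, marg₀_pairVec₂, marg₁_pairVec₂]
  exact ⟨pairVec_mem B T.1, pairVec_mem B T.2⟩

omit [AddGroup B] in
/-- `pairs₂ ≤ hodge₂`. [folklore] -/
theorem pairs₂_le_hodge₂ : pairs₂ B ≤ hodge₂ B := by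
  refine Submodule.span_le.mpr ?_
  rintro _ ⟨T, rfl⟩
  exact pairVec₂_mem B T

omit [AddGroup B] [DecidableEq B] in
/-- A pair lies in `pairs₂`. [folklore] -/
theorem pairVec₂_mem_pairs₂ (T : Ty₂ B) : pairVec₂ B T ∈ pairs₂ B := Submodule.subset_span ⟨T, rfl⟩

omit [AddGroup B] in
/-- **Outer products with a Hodge factor of mass zero on the left are octic Hodge vectors** (coset faces in coordinate `0`). [folklore] -/
theorem tens_mem_hodge₂_left {v : Ty B → ℤ} (hv : v ∈ hodge B) (hv0 : ∑ s, v s = 0) (w : Ty B → ℤ) : tens B v w ∈ hodge₂ B := by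
  rw [mem_hodge₂_iff, marg₀_tens, marg₁_tens, hv0, zero_smul]
  exact ⟨Submodule.smul_mem _ _ hv, Submodule.zero_mem _⟩

omit [AddGroup B] in
/-- **Outer products with a Hodge factor of mass zero on the right are octic Hodge vectors** (coset faces in coordinate `1`). [folklore] -/
theorem tens_mem_hodge₂_right (v : Ty B → ℤ) {w : Ty B → ℤ} (hw : w ∈ hodge B) (hw0 : ∑ t, w t = 0) : tens B v w ∈ hodge₂ B := by
  rw [mem_hodge₂_iff, marg₀_tens, marg₁_tens, hw0, zero_smul]
  exact ⟨Submodule.zero_mem _, Submodule.smul_mem _ _ hw⟩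

omit [AddGroup B] in
/-- **Outer products of two vectors of mass zero are octic Hodge vectors** (both marginals vanish: mixed faces, bi-differences). [folklore] -/
theorem tens_mem_hodge₂_of_sum_eq_zero {v w : Ty B → ℤ} (hv0 : ∑ s, v s = 0) (hw0 : ∑ t, w t = 0) : tens B v w ∈ hodge₂ B := by
  rw [mem_hodge₂_iff, marg₀_tens, marg₁_tens, hv0, hw0, zero_smul, zero_smul]
  exact ⟨Submodule.zero_mem _, Submodule.zero_mem _⟩

/-! ## §3 Motions: the diagonal quartic twists and the swap-twist `sig` -/

/-- The diagonal action of `h ∈ ℤ/4 × B`. [folklore] -/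
def tw₂ (h : ZMod 4 × B) (T : Ty₂ B) : Ty₂ B := (tw B h T.1, tw B h T.2)

/-- **The swap-twist** (the generator `x = (1,0)` of `ℤ/8 × B` modulo `H`): `sig (s,t) = (tw (1,0) t, s)`. [folklore] -/
def sig (T : Ty₂ B) : Ty₂ B := (tw B (1, 0) T.2, T.1)

omit [Fintype B] [DecidableEq B] in
/-- `tw₂ g ∘ tw₂ h = tw₂ (g + h)`. [folklore] -/
theorem tw₂_tw₂ (g h : ZMod 4 × B) (T : Ty₂ B) : tw₂ B g (tw₂ B h T) = tw₂ B (g + h) T := by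
  unfold tw₂
  rw [tw_tw, tw_tw]

omit [Fintype B] [DecidableEq B] in
/-- `tw₂ 0 = id`. [folklore] -/
theorem tw₂_zero (T : Ty₂ B) : tw₂ B 0 T = T := by
  unfold tw₂
  rw [tw_zero, tw_zero]

omit [Fintype B] [DecidableEq B] in
/-- `(1,0)` is central in `ℤ/4 × B` (any `B`). [folklore] -/
theorem one_zero_add_comm (h : ZMod 4 × B) : (1, 0) + h = h + (1, 0) :=
  Prod.ext (add_comm _ _) (by rw [Prod.snd_add, Prod.snd_add, zero_add, add_zero])

omit [Fintype B] [DecidableEq B] in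
/-- **`sig` commutes with the diagonal action.** [folklore] -/
theorem sig_tw₂ (h : ZMod 4 × B) (T : Ty₂ B) : sig B (tw₂ B h T) = tw₂ B h (sig B T) := by
  unfold sig tw₂
  simp only
  rw [tw_tw, tw_tw, one_zero_add_comm]

omit [Fintype B] [DecidableEq B] in
/-- **`sig ∘ sig = tw₂ (1,0)`** (`x² = (1,0)_H`). [folklore] -/
theorem sig_sig (T : Ty₂ B) : sig B (sig B T) = tw₂ B (1, 0) T := rfl

omit [Fintype B] [DecidableEq B] in
/-- `−(1,0) − h = −h − (1,0)` (`(1,0)` central). [folklore] -/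
theorem neg_one_zero_sub (h : ZMod 4 × B) : -((1 : ZMod 4), (0 : B)) - h = -h - (1, 0) := by
  rw [sub_eq_add_neg, sub_eq_add_neg, ← neg_add_rev, ← neg_add_rev, one_zero_add_comm]

/-- **The motions** `act e h = tw₂ h ∘ sigᵉ` (`e : Bool`): all of `G = H ⊔ xH`. [folklore] -/
def act (e : Bool) (h : ZMod 4 × B) (T : Ty₂ B) : Ty₂ B := tw₂ B h (if e then sig B T else T)

omit [Fintype B] [DecidableEq B] in
/-- `act false h = tw₂ h`. [folklore] -/
theorem act_false (h : ZMod 4 × B) (T : Ty₂ B) : act B false h T = tw₂ B h T := rfl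

omit [Fintype B] [DecidableEq B] in
/-- `act true h = tw₂ h ∘ sig`. [folklore] -/
theorem act_true (h : ZMod 4 × B) (T : Ty₂ B) : act B true h T = tw₂ B h (sig B T) := rfl

omit [Fintype B] [DecidableEq B] in
/-- Composition of motions, `tw₂ g ∘ tw₂ h`. [folklore] -/
theorem act_false_false (g h : ZMod 4 × B) (T : Ty₂ B) : act B false g (act B false h T) = act B false (g + h) T := by
  rw [act_false, act_false, act_false, tw₂_tw₂]

omit [Fintype B] [DecidableEq B] in
/-- Composition of motions, `tw₂ g ∘ (tw₂ h ∘ sig)`. [folklore] -/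
theorem act_false_true (g h : ZMod 4 × B) (T : Ty₂ B) : act B false g (act B true h T) = act B true (g + h) T := by
  rw [act_false, act_true, act_true, tw₂_tw₂]

omit [Fintype B] [DecidableEq B] in
/-- Composition of motions, `(tw₂ g ∘ sig) ∘ tw₂ h`. [folklore] -/
theorem act_true_false (g h : ZMod 4 × B) (T : Ty₂ B) : act B true g (act B false h T) = act B true (g + h) T := by
  rw [act_true, act_false, act_true, sig_tw₂, tw₂_tw₂]

omit [Fintype B] [DecidableEq B] in
/-- **Composition of motions, `(tw₂ g ∘ sig) ∘ (tw₂ h ∘ sig) = tw₂ (g + h + (1,0))`.** [folklore] -/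
theorem act_true_true (g h : ZMod 4 × B) (T : Ty₂ B) : act B true g (act B true h T) = act B false (g + h + (1, 0)) T := by
  rw [act_true, act_true, act_false, sig_tw₂, sig_sig, tw₂_tw₂, tw₂_tw₂]

/-- **The inverse motion**: `(tw₂ h)⁻¹ = tw₂ (−h)`, `(tw₂ h ∘ sig)⁻¹ = tw₂ (−(1,0) − h) ∘ sig`. [folklore] -/
def actInv (e : Bool) (h : ZMod 4 × B) (T : Ty₂ B) : Ty₂ B := act B e (if e then -(1, 0) - h else -h) T

omit [Fintype B] [DecidableEq B] in
/-- `actInv false h = tw₂ (−h)`. [folklore] -/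
theorem actInv_false (h : ZMod 4 × B) (T : Ty₂ B) : actInv B false h T = act B false (-h) T := rfl

omit [Fintype B] [DecidableEq B] in
/-- `actInv true h = tw₂ (−(1,0) − h) ∘ sig`. [folklore] -/
theorem actInv_true (h : ZMod 4 × B) (T : Ty₂ B) : actInv B true h T = act B true (-(1, 0) - h) T := rfl

omit [Fintype B] [DecidableEq B] in
/-- `actInv` is a left inverse of `act`. [folklore] -/
theorem actInv_act (e : Bool) (h : ZMod 4 × B) (T : Ty₂ B) : actInv B e h (act B e h T) = T := by
  cases e
  · rw [actInv_false, act_false_false, neg_add_cancel, act_false, tw₂_zero]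
  · rw [actInv_true, act_true_true, sub_add_cancel, neg_add_cancel, act_false, tw₂_zero]

omit [Fintype B] [DecidableEq B] in
/-- `actInv` is a right inverse of `act`. [folklore] -/
theorem act_actInv (e : Bool) (h : ZMod 4 × B) (T : Ty₂ B) : act B e h (actInv B e h T) = T := by
  cases e
  · rw [actInv_false, act_false_false, add_neg_cancel, act_false, tw₂_zero]
  · rw [actInv_true, act_true_true, neg_one_zero_sub, ← add_sub_assoc, add_neg_cancel, zero_sub, neg_add_cancel, act_false,
      tw₂_zero]

/-- **A motion as a permutation of the pair types.** [folklore] -/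
def actEquiv (e : Bool) (h : ZMod 4 × B) : Ty₂ B ≃ Ty₂ B where
  toFun := act B e h
  invFun := actInv B e h
  left_inv := actInv_act B e h
  right_inv := act_actInv B e h

/-- **The orbit relation of the motions** (`G = ℤ/8 × B` acting on the octic types). [folklore] -/
def orbitRel₂ : Setoid (Ty₂ B) where
  r T T' := ∃ (e : Bool) (h : ZMod 4 × B), act B e h T = T'
  iseqv := by
    refine ⟨fun T => ⟨false, 0, by rw [act_false, tw₂_zero]⟩, ?_, ?_⟩
    · rintro T T' ⟨e, h, rfl⟩
      exact ⟨e, if e then -(1, 0) - h else -h, actInv_act B e h T⟩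
    · rintro T T' T'' ⟨e, h, rfl⟩ ⟨e', h', rfl⟩
      cases e <;> cases e'
      · exact ⟨false, h' + h, (act_false_false B h' h T).symm⟩
      · exact ⟨true, h' + h, (act_true_false B h' h T).symm⟩
      · exact ⟨true, h' + h, (act_false_true B h' h T).symm⟩
      · exact ⟨false, h' + h + (1, 0), (act_true_true B h' h T).symm⟩

/-- **The octic blocks**: orbits of the motions on the pair types. [folklore] -/
abbrev Orb₂ : Type := Quotient (orbitRel₂ B)

/-- The octic blocks form a finite type. [folklore] -/
noncomputable instance : Fintype (Orb₂ B) := Fintype.ofFinite _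

omit [Fintype B] [DecidableEq B] in
/-- Octic pairs are carried to octic pairs by every motion. [folklore] -/
theorem act_add_two (e : Bool) (h : ZMod 4 × B) (T : Ty₂ B) :
    act B e h (T.1 + 2, T.2 + 2) = ((act B e h T).1 + 2, (act B e h T).2 + 2) := by
  cases e
  · simp only [act_false, tw₂, tw_add_two]
  · simp only [act_true, tw₂, sig, tw_add_two]

end Summit.HodgeConjecture.CorCM.Census.OcticTwist
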